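import Summits.ResolutionOfSingularities.ResolutionOfSingularities.Theorems.RadicialJungCleanModelsCcurvePersistTwo
import HarnessLib

/-!
# Route `RadicialJung`, crux `CleanModels` (stmt-15917) — (C-curve) sub-line: `stub_Cc_persistForm1` modulo the shared stub `stub_Cc_centreCurve` only

Lead `res-B-lead-1` g7 (plan `Cruxes/CleanModels/Lines/Sketch-memo-Ccurve-plan.md` §1 S5c/S5d; workfile `Lines/Sketch_Ccurve_assembly.lean` v2.8 stub
`Ccurve.stub_Cc_persistForm1`).  OURS · counted 0.  Nothing here proves resolution in characteristic `p`; resolution in char `p` is NOT proved.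

`persistForm1_of`: the statement of `stub_Cc_persistForm1` (closed-point persist, FORM (1) at the local ring `S₁ = locAtCentre B O₁` of the centre curve:
`G = u · ∏_{i<m} t_i^{a_i}`, `m ∈ {1, 2}`, `(t₀, t₁)` an r.s.p. of `S₁`, `p ∤ a_i`) from ONE hypothesis stated as a closed proposition: (hS3) the shared stub
`stub_Cc_centreCurve` VERBATIM.  Route: S3 ⇒ r.s.p. `(x, y, z)` of `S' = locAtCentre B′ O` with `(x, y)` the centre of `O₁`; `u = a/b`, `t_i = (x α_i + y β_i)/γ_i`
(✓ `exists_numerator_of_valuation_lt`); ✓ `conormal_det` (`v₁(α₀β₁ − α₁β₀) = 1`, hence each row is off `(x, y) × (x, y)`); `K^p`-rescaling by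
`D = b · ∏ γ_i^{a_i}`; `m = 1` ⇒ ✓ `persist_one_core`; `m = 2` ⇒ ✓ `row_decomp` twice, orientation of row `0` by the symmetry `x ↔ y`, ✓ `persist_two_core`
(point blow-ups, and in the tangent case the Γ-rounds = one call of ✓ `exists_model_rsop_div_pow`).  Output: loose-clean FORM (1).
-/

noncomputable section

set_option linter.dupNamespace false

open IsLocalRing Literature.AlgebraicGeometry.Resolution
open Summit.ResolutionOfSingularities.ResolutionOfSingularities.Theorems

namespace Summit.ResolutionOfSingularities.ResolutionOfSingularities.Theorems.RadicialJung.CleanModels.Ccurve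

/-- Transport of «`𝔪 = (t₀, t₁)`» along an equality of local subrings of `K`. [folklore] -/
theorem maximalIdeal_eq_span_pair_iff_of_eq {K : Type} [Field K] {R₁ R₂ : Subring K} (h : R₁ = R₂) [IsLocalRing ↥R₁] [IsLocalRing ↥R₂]
    {t₀ t₁ : K} (h₀ : t₀ ∈ R₁) (h₁ : t₁ ∈ R₁) (h₀' : t₀ ∈ R₂) (h₁' : t₁ ∈ R₂) :
    IsLocalRing.maximalIdeal ↥R₁ = Ideal.span {⟨t₀, h₀⟩, ⟨t₁, h₁⟩} ↔ IsLocalRing.maximalIdeal ↥R₂ = Ideal.span {⟨t₀, h₀'⟩, ⟨t₁, h₁'⟩} := by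
  subst h
  exact Iff.rfl

/-- If `v₁ (α₀ β₁ − α₁ β₀) = 1` for elements of `O₁`, then each row is unimodular: `v₁ α₀ = 1 ∨ v₁ β₀ = 1` (and symmetrically). [folklore] -/
theorem row_unimodular_of_det {K : Type} [Field K] (O₁ : ValuationSubring K) {α₀ β₀ α₁ β₁ : K}
    (hα₀ : α₀ ∈ O₁) (hβ₀ : β₀ ∈ O₁) (hα₁ : α₁ ∈ O₁) (hβ₁ : β₁ ∈ O₁) (hdet : O₁.valuation (α₀ * β₁ - α₁ * β₀) = 1) :
    (O₁.valuation α₀ = 1 ∨ O₁.valuation β₀ = 1) ∧ (O₁.valuation α₁ = 1 ∨ O₁.valuation β₁ = 1) := by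
  have hle : ∀ {w : K}, w ∈ O₁ → O₁.valuation w ≤ 1 := fun hw => (O₁.valuation_le_one_iff _).mpr hw
  have key : ∀ {a b c d : K}, a ∈ O₁ → b ∈ O₁ → c ∈ O₁ → d ∈ O₁ → O₁.valuation (a * d - c * b) = 1 →
      (O₁.valuation a = 1 ∨ O₁.valuation b = 1) := by
    intro a b c d ha hb hc hd h
    by_contra hcon
    push Not at hcon
    have ha' : O₁.valuation a < 1 := lt_of_le_of_ne (hle ha) hcon.1
    have hb' : O₁.valuation b < 1 := lt_of_le_of_ne (hle hb) hcon.2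
    have h1 : O₁.valuation (a * d) < 1 := valuation_mul_lt_one_of_lt_of_mem O₁ ha' hd
    have h2 : O₁.valuation (c * b) < 1 := by rw [mul_comm]; exact valuation_mul_lt_one_of_lt_of_mem O₁ hb' hc
    have : O₁.valuation (a * d - c * b) < 1 := lt_of_le_of_lt (Valuation.map_sub _ _ _) (max_lt h1 h2)
    rw [h] at this; exact lt_irrefl _ this
  refine ⟨key hα₀ hβ₀ hα₁ hβ₁ hdet, key hα₁ hβ₁ hα₀ hβ₀ ?_⟩
  rw [← Valuation.map_neg, show -(α₁ * β₀ - α₀ * β₁) = α₀ * β₁ - α₁ * β₀ by ring]; exact hdet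

/-- **`stub_Cc_persistForm1` modulo the shared stub `stub_Cc_centreCurve` (S3)** — see the module docstring. [folklore] -/
theorem persistForm1_of
    (hS3 :
    ∀ (k : Type) [Field k] (K : Type) [Field K] [Algebra k K]
    (O : ValuationSubring K) (A : Subalgebra k K), A.toSubring ≤ O.toSubring → A.FG → IsFractionRing A K → ringKrullDim A ≤ 3 →
    (∀ (T : Subring K) (hT : T ≤ O.toSubring), A.toSubring ≤ T → (subringCentre T O hT).IsMaximal) →
    ∀ (B : Subalgebra k K) (hBO : B.toSubring ≤ O.toSubring), A ≤ B → B.FG →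
    IsRegularLocalRing (locAtCentre B.toSubring O) → ringKrullDim (locAtCentre B.toSubring O) = 3 →
    ∀ (O₁ : ValuationSubring K), O ≤ O₁ → ringKrullDim (locAtCentre B.toSubring O₁) = 2 →
    ∃ (B' : Subalgebra k K) (hB'O : B'.toSubring ≤ O.toSubring), B ≤ B' ∧ B'.FG ∧
    IsRegularLocalRing (locAtCentre B'.toSubring O) ∧ ringKrullDim (locAtCentre B'.toSubring O) = 3 ∧
    locAtCentre B'.toSubring O₁ = locAtCentre B.toSubring O₁ ∧
    ∃ (x y z : K) (hx : x ∈ locAtCentre B'.toSubring O) (hy : y ∈ locAtCentre B'.toSubring O) (hz : z ∈ locAtCentre B'.toSubring O),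
      (haveI := isLocalRing_locAtCentre hB'O; IsLocalRing.maximalIdeal (locAtCentre B'.toSubring O)) =
        Ideal.span {⟨x, hx⟩, ⟨y, hy⟩, ⟨z, hz⟩} ∧
      ∀ w : ↥(locAtCentre B'.toSubring O), O₁.valuation (w : K) < 1 ↔ w ∈ Ideal.span {(⟨x, hx⟩ : ↥(locAtCentre B'.toSubring O)), ⟨y, hy⟩} )
    :
    ∀ (p : ℕ), p.Prime →
    ∀ (k : Type) [Field k] [CharP k p] [PerfectField k] (K : Type) [Field K] [Algebra k K]
    (O : ValuationSubring K) (A : Subalgebra k K), A.toSubring ≤ O.toSubring → A.FG → IsFractionRing A K →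
    ringKrullDim A ≤ 3 → IsRegularLocalRing (locAtCentre A.toSubring O) →
    ringKrullDim (locAtCentre A.toSubring O) = 3 →
    (∀ (T : Subring K) (hT : T ≤ O.toSubring), A.toSubring ≤ T → (subringCentre T O hT).IsMaximal) →
    ∀ g₀ : K, (∀ c : K, c ^ p ≠ g₀) →
    ¬ (∃ (O₁ : ValuationSubring K), O ≤ O₁ ∧ O₁ ≠ ⊤ ∧ ∃ y : Fin 2 → K, (∀ i, y i ∈ O) ∧
      ∀ P : MvPolynomial (Fin 2) k, P ≠ 0 → O₁.valuation (MvPolynomial.aeval y P) = 1) →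
    ∀ (O₁ : ValuationSubring K), O ≤ O₁ → O₁ ≠ O → O₁ ≠ ⊤ →
    ∀ (B : Subalgebra k K), B.toSubring ≤ O.toSubring → A ≤ B → B.FG →
    IsRegularLocalRing (locAtCentre B.toSubring O) → ringKrullDim (locAtCentre B.toSubring O) = 3 →
    ringKrullDim ↥(locAtCentre B.toSubring O₁) = 2 →
    ∀ (_ : IsRegularLocalRing ↥(locAtCentre B.toSubring O₁)) (c : Fin p → K), (∃ j : Fin p, (j : ℕ) ≠ 0 ∧ c j ≠ 0) →
    (∃ (d m : ℕ) (hmd : m ≤ d) (t : Fin d → ↥(locAtCentre B.toSubring O₁)) (a : Fin m → ℕ) (u : ↥(locAtCentre B.toSubring O₁)), IsUnit u ∧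
    Ideal.span (Set.range t) = IsLocalRing.maximalIdeal ↥(locAtCentre B.toSubring O₁) ∧
    ringKrullDim ↥(locAtCentre B.toSubring O₁) = (d : WithBot ℕ∞) ∧ 0 < m ∧ (∀ i, ¬ p ∣ a i) ∧
    (∑ j : Fin p, c j ^ p * g₀ ^ (j : ℕ)) = (u : K) * ∏ i : Fin m, ((t (Fin.castLE hmd i) : ↥(locAtCentre B.toSubring O₁)) : K) ^ (a i)) →
    ∃ (A' : Subalgebra k K), A'.toSubring ≤ O.toSubring ∧ A ≤ A' ∧ A'.FG ∧
    ∃ (_ : IsRegularLocalRing ↥(locAtCentre A'.toSubring O)) (c : Fin p → K), (∃ j : Fin p, (j : ℕ) ≠ 0 ∧ c j ≠ 0) ∧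
    ((∃ (d m : ℕ) (hmd : m ≤ d) (t : Fin d → ↥(locAtCentre A'.toSubring O)) (a : Fin m → ℕ) (u : ↥(locAtCentre A'.toSubring O)), IsUnit u ∧
    Ideal.span (Set.range t) = IsLocalRing.maximalIdeal ↥(locAtCentre A'.toSubring O) ∧
    ringKrullDim ↥(locAtCentre A'.toSubring O) = (d : WithBot ℕ∞) ∧ 0 < m ∧ (∀ i, ¬ p ∣ a i) ∧
    (∑ j : Fin p, c j ^ p * g₀ ^ (j : ℕ)) = (u : K) * ∏ i : Fin m, ((t (Fin.castLE hmd i) : ↥(locAtCentre A'.toSubring O)) : K) ^ (a i)) ∨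
    (∃ u : ↥(locAtCentre A'.toSubring O), IsUnit u ∧ (∑ j : Fin p, c j ^ p * g₀ ^ (j : ℕ)) = (u : K) ∧
    ∀ c' : ↥(locAtCentre A'.toSubring O), u - c' ^ p ∉ IsLocalRing.maximalIdeal ↥(locAtCentre A'.toSubring O)) ∨
    (∃ s c' : ↥(locAtCentre A'.toSubring O), (∑ j : Fin p, c j ^ p * g₀ ^ (j : ℕ)) = (s : K) ∧
    s - c' ^ p ∈ IsLocalRing.maximalIdeal ↥(locAtCentre A'.toSubring O) ∧
    s - c' ^ p ∉ IsLocalRing.maximalIdeal ↥(locAtCentre A'.toSubring O) ^ 2)) := by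
  intro p hp k _ _ _ K _ _ O A hAO hAfg hfrac hdimA hreg hdim3 hzd g₀ hg₀ hdiv O₁ hOO₁ hne hO₁ B hBO hAB hBfg hBreg hBdim hBdim₁ hreg₁ c hc h1
  classical
  haveI : Fact p.Prime := ⟨hp⟩
  haveI := hfrac
  have hBO₁ : B.toSubring ≤ O₁.toSubring := fun w hw => hOO₁ (hBO hw)
  haveI := isLocalRing_locAtCentre hBO₁
  obtain ⟨d, m, hmd, t, a, u, hu, hspan, hdimd, hm, ha, hGu⟩ := h1
  -- `d = 2`
  have hd2 : d = 2 := by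
    have h := hdimd.symm.trans hBdim₁
    exact_mod_cast h
  subst hd2
  -- S3: the centre curve made regular
  obtain ⟨B', hB'O, hBB', hB'fg, hB'reg, hB'dim, hloc₁, x, y, z, hx, hy, hz, hmax, hcen⟩ :=
    hS3 k K O A hAO hAfg hfrac hdimA hzd B hBO hAB hBfg hBreg hBdim O₁ hOO₁ hBdim₁
  haveI := isLocalRing_locAtCentre hB'O
  haveI : IsRegularLocalRing ↥(locAtCentre B'.toSubring O) := hB'reg
  have hB'O₁ : B'.toSubring ≤ O₁.toSubring := fun w hw => hOO₁ (hB'O hw)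
  haveI := isLocalRing_locAtCentre hB'O₁
  haveI hreg₁' : IsRegularLocalRing ↥(locAtCentre B'.toSubring O₁) := by rw [hloc₁]; exact hreg₁
  have hdim₁' : ringKrullDim ↥(locAtCentre B'.toSubring O₁) = 2 := by rw [hloc₁]; exact hBdim₁
  -- the generators `t₀, t₁` as elements of `K`
  obtain ⟨T₀, hT₀K⟩ : ∃ T₀ : K, T₀ = (t 0 : K) := ⟨_, rfl⟩
  obtain ⟨T₁, hT₁K⟩ : ∃ T₁ : K, T₁ = (t 1 : K) := ⟨_, rfl⟩
  have hT₀B : T₀ ∈ locAtCentre B.toSubring O₁ := by rw [hT₀K]; exact (t 0).2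
  have hT₁B : T₁ ∈ locAtCentre B.toSubring O₁ := by rw [hT₁K]; exact (t 1).2
  have hT₀' : T₀ ∈ locAtCentre B'.toSubring O₁ := by rw [hloc₁]; exact hT₀B
  have hT₁' : T₁ ∈ locAtCentre B'.toSubring O₁ := by rw [hloc₁]; exact hT₁B
  have ht0 : t 0 = ⟨T₀, hT₀B⟩ := Subtype.ext hT₀K.symm
  have ht1 : t 1 = ⟨T₁, hT₁B⟩ := Subtype.ext hT₁K.symm
  have hgenB : IsLocalRing.maximalIdeal ↥(locAtCentre B.toSubring O₁) = Ideal.span {⟨T₀, hT₀B⟩, ⟨T₁, hT₁B⟩} := by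
    rw [← hspan, ← ht0, ← ht1]
    congr 1; ext v; simp only [Set.mem_range, Set.mem_insert_iff, Set.mem_singleton_iff]
    constructor
    · rintro ⟨j, rfl⟩; fin_cases j <;> simp
    · rintro (rfl | rfl); exacts [⟨0, rfl⟩, ⟨1, rfl⟩]
  have hgen' : IsLocalRing.maximalIdeal ↥(locAtCentre B'.toSubring O₁) = Ideal.span {⟨T₀, hT₀'⟩, ⟨T₁, hT₁'⟩} :=
    (maximalIdeal_eq_span_pair_iff_of_eq hloc₁ hT₀' hT₁' hT₀B hT₁B).mpr hgenB
  have hvT₀ : O₁.valuation T₀ < 1 :=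
    (mem_maximalIdeal_locAtCentre_iff hB'O₁ ⟨T₀, hT₀'⟩).mp (by rw [hgen']; exact Ideal.subset_span (by simp))
  have hvT₁ : O₁.valuation T₁ < 1 :=
    (mem_maximalIdeal_locAtCentre_iff hB'O₁ ⟨T₁, hT₁'⟩).mp (by rw [hgen']; exact Ideal.subset_span (by simp))
  obtain ⟨α₀, β₀, γ₀, hα₀, hβ₀, hγ₀, hvγ₀, hT₀eq⟩ := exists_numerator_of_valuation_lt hx hy hcen hT₀' hvT₀
  obtain ⟨α₁, β₁, γ₁, hα₁, hβ₁, hγ₁, hvγ₁, hT₁eq⟩ := exists_numerator_of_valuation_lt hx hy hcen hT₁' hvT₁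
  have hγ₀0 : γ₀ ≠ 0 := ne_zero_of_valuation_eq_one hvγ₀
  have hγ₁0 : γ₁ ≠ 0 := ne_zero_of_valuation_eq_one hvγ₁
  -- the conormal determinant
  subst hT₀eq hT₁eq
  have hS'S₁ : locAtCentre B'.toSubring O ≤ locAtCentre B'.toSubring O₁ := le_locAtCentre_coarse hOO₁
  have hdet : O₁.valuation (α₀ * β₁ - α₁ * β₀) = 1 :=
    conormal_det hB'O hOO₁ hx hy hcen hdim₁' (hS'S₁ hα₀) (hS'S₁ hβ₀) (le_locAtCentre _ _ hγ₀) hvγ₀ (hS'S₁ hα₁) (hS'S₁ hβ₁)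
      (le_locAtCentre _ _ hγ₁) hvγ₁ hT₀' hT₁' hgen'
  have hO₁mem : ∀ {w : K}, w ∈ locAtCentre B'.toSubring O → w ∈ O₁ := fun hw => hOO₁ (locAtCentre_le hB'O hw)
  obtain ⟨huni₀, huni₁⟩ := row_unimodular_of_det O₁ (hO₁mem hα₀) (hO₁mem hβ₀) (hO₁mem hα₁) (hO₁mem hβ₁) hdet
  -- the unit `u = a / b`
  have huK : (u : K) ∈ locAtCentre B'.toSubring O₁ := by rw [hloc₁]; exact u.2
  obtain ⟨ua, hua, ub, hub, hvub, huab⟩ := mem_locAtCentre_iff.mp huK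
  have hub0 : ub ≠ 0 := ne_zero_of_valuation_eq_one hvub
  have hvu : O₁.valuation (u : K) = 1 := (isUnit_locAtCentre_iff hBO₁ u).mp hu
  have hvua : O₁.valuation ua = 1 := by
    have : ua = (u : K) * ub := by rw [huab]; field_simp
    rw [this, map_mul, hvu, hvub, mul_one]
  haveI : CharP K p := charP_of_injective_algebraMap (algebraMap k K).injective p
  obtain ⟨q, hq⟩ : ∃ q, p = q + 1 := ⟨p - 1, (Nat.sub_add_cancel hp.one_lt.le).symm⟩
  -- `m = 1` or `m = 2`
  interval_cases m
  · -- ONE FACTOR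
    have hG₁ : (∑ j : Fin p, c j ^ p * g₀ ^ (j : ℕ)) = (u : K) * ((x * α₀ + y * β₀) / γ₀) ^ a 0 := by
      rw [hGu, Fin.prod_univ_one]
      have : t (Fin.castLE hmd 0) = t 0 := congrArg t (Fin.ext rfl)
      rw [this, ht0]
    set D : K := ub * γ₀ ^ a 0 with hD
    have hD0 : D ≠ 0 := mul_ne_zero hub0 (pow_ne_zero _ hγ₀0)
    let c' : Fin p → K := fun j => c j * D
    have hc' : ∃ j : Fin p, (j : ℕ) ≠ 0 ∧ c' j ≠ 0 := exists_ne_zero_mul_of_exists hc hD0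
    set A₀ : K := ua * ub ^ q * γ₀ ^ (q * a 0) with hA₀
    have hA₀m : A₀ ∈ locAtCentre B'.toSubring O := Subring.mul_mem _ (Subring.mul_mem _ (le_locAtCentre _ _ hua)
      (Subring.pow_mem _ (le_locAtCentre _ _ hub) _)) (Subring.pow_mem _ (le_locAtCentre _ _ hγ₀) _)
    have hvA₀ : O₁.valuation A₀ = 1 := by rw [hA₀, map_mul, map_mul, map_pow, map_pow, hvua, hvub, hvγ₀, one_pow, one_pow, mul_one, mul_one]
    have hG' : (∑ j : Fin p, c' j ^ p * g₀ ^ (j : ℕ)) = A₀ * (x * α₀ + y * β₀) ^ a 0 := by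
      change (∑ j : Fin p, (c j * D) ^ p * g₀ ^ (j : ℕ)) = _
      have e1 : (ub * γ₀ ^ a 0) ^ p = (ub ^ q * γ₀ ^ (q * a 0)) * (ub * γ₀ ^ a 0) := by
        rw [hq, pow_succ, mul_pow, ← pow_mul, Nat.mul_comm (a 0) q]
      rw [sum_mul_pow_rescale, hG₁, huab, hD, hA₀, e1, div_pow]
      field_simp
    exact persist_one_core p hp O A hAO hAfg hdimA hzd B' hB'O (hAB.trans hBB') hB'fg hB'reg hB'dim O₁ hOO₁ x y z hx hy hz hmax hcen g₀ c' hc'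
      A₀ α₀ β₀ hA₀m hvA₀ hα₀ hβ₀ huni₀ (a 0) (ha 0) hG'
  · -- TWO FACTORS
    have hG₂ : (∑ j : Fin p, c j ^ p * g₀ ^ (j : ℕ)) = (u : K) * ((x * α₀ + y * β₀) / γ₀) ^ a 0 * ((x * α₁ + y * β₁) / γ₁) ^ a 1 := by
      rw [hGu, Fin.prod_univ_two]
      have h0 : t (Fin.castLE hmd 0) = t 0 := congrArg t (Fin.ext rfl)
      have h1 : t (Fin.castLE hmd 1) = t 1 := congrArg t (Fin.ext rfl)
      rw [h0, h1, ht0, ht1, mul_assoc]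
    set D : K := ub * γ₀ ^ a 0 * γ₁ ^ a 1 with hD
    have hD0 : D ≠ 0 := mul_ne_zero (mul_ne_zero hub0 (pow_ne_zero _ hγ₀0)) (pow_ne_zero _ hγ₁0)
    let c' : Fin p → K := fun j => c j * D
    have hc' : ∃ j : Fin p, (j : ℕ) ≠ 0 ∧ c' j ≠ 0 := exists_ne_zero_mul_of_exists hc hD0
    set A₀ : K := ua * ub ^ q * γ₀ ^ (q * a 0) * γ₁ ^ (q * a 1) with hA₀
    have hA₀m : A₀ ∈ locAtCentre B'.toSubring O := Subring.mul_mem _ (Subring.mul_mem _ (Subring.mul_mem _ (le_locAtCentre _ _ hua)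
      (Subring.pow_mem _ (le_locAtCentre _ _ hub) _)) (Subring.pow_mem _ (le_locAtCentre _ _ hγ₀) _)) (Subring.pow_mem _ (le_locAtCentre _ _ hγ₁) _)
    have hvA₀ : O₁.valuation A₀ = 1 := by
      rw [hA₀, map_mul, map_mul, map_mul, map_pow, map_pow, map_pow, hvua, hvub, hvγ₀, hvγ₁, one_pow, one_pow, one_pow, mul_one, mul_one, mul_one]
    have hG' : (∑ j : Fin p, c' j ^ p * g₀ ^ (j : ℕ)) = A₀ * (x * α₀ + y * β₀) ^ a 0 * (x * α₁ + y * β₁) ^ a 1 := by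
      change (∑ j : Fin p, (c j * D) ^ p * g₀ ^ (j : ℕ)) = _
      have e1 : (ub * γ₀ ^ a 0 * γ₁ ^ a 1) ^ p = (ub ^ q * γ₀ ^ (q * a 0) * γ₁ ^ (q * a 1)) * (ub * γ₀ ^ a 0 * γ₁ ^ a 1) := by
        rw [hq, pow_succ, mul_pow, mul_pow, ← pow_mul, ← pow_mul, Nat.mul_comm (a 0) q, Nat.mul_comm (a 1) q]
      rw [sum_mul_pow_rescale, hG₂, huab, hD, hA₀, e1, div_pow, div_pow]
      field_simp
    -- row decompositions
    obtain ⟨e₀, a₀', b₀', a₀₁, a₀₂, b₀₁, b₀₂, ha₀', hb₀', ha₀₁, ha₀₂, hb₀₁, hb₀₂, hα₀eq, hβ₀eq, huni₀'⟩ :=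
      row_decomp hB'O hOO₁ hB'dim hx hy hz hmax hcen hα₀ hβ₀ huni₀
    obtain ⟨e₁, a₁', b₁', a₁₁, a₁₂, b₁₁, b₁₂, ha₁', hb₁', ha₁₁, ha₁₂, hb₁₁, hb₁₂, hα₁eq, hβ₁eq, huni₁'⟩ :=
      row_decomp hB'O hOO₁ hB'dim hx hy hz hmax hcen hα₁ hβ₁ huni₁
    rcases huni₀' with hva₀' | hvb₀'
    · -- row 0 oriented as is
      exact persist_two_core p hp O A hAO hAfg hdimA hzd B' hB'O (hAB.trans hBB') hB'fg hB'reg hB'dim O₁ hOO₁ x y z hx hy hz hmax hcen g₀ c' hc'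
        A₀ hA₀m hvA₀ α₀ β₀ α₁ β₁ e₀ e₁ a₀' b₀' a₀₁ a₀₂ b₀₁ b₀₂ a₁' b₁' a₁₁ a₁₂ b₁₁ b₁₂ ha₀' hb₀' ha₀₁ ha₀₂ hb₀₁ hb₀₂ ha₁' hb₁' ha₁₁ ha₁₂ hb₁₁ hb₁₂
        hα₀eq hβ₀eq hα₁eq hβ₁eq hva₀' huni₁' hdet (a 0) (a 1) (ha 0) (ha 1) hG'
    · -- swap the roles of `x` and `y`
      have hmax' : IsLocalRing.maximalIdeal ↥(locAtCentre B'.toSubring O) = Ideal.span {⟨y, hy⟩, ⟨x, hx⟩, ⟨z, hz⟩} := by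
        rw [hmax, Set.insert_comm]
      have hcen' : ∀ w : ↥(locAtCentre B'.toSubring O), O₁.valuation (w : K) < 1 ↔
          w ∈ Ideal.span {(⟨y, hy⟩ : ↥(locAtCentre B'.toSubring O)), ⟨x, hx⟩} := by
        intro w; rw [hcen w, Set.pair_comm]
      have hG'' : (∑ j : Fin p, c' j ^ p * g₀ ^ (j : ℕ)) = A₀ * (y * β₀ + x * α₀) ^ a 0 * (y * β₁ + x * α₁) ^ a 1 := by
        rw [hG']; ring
      have hdet' : O₁.valuation (β₀ * α₁ - β₁ * α₀) = 1 := by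
        rw [← Valuation.map_neg, show -(β₀ * α₁ - β₁ * α₀) = α₀ * β₁ - α₁ * β₀ by ring]; exact hdet
      exact persist_two_core p hp O A hAO hAfg hdimA hzd B' hB'O (hAB.trans hBB') hB'fg hB'reg hB'dim O₁ hOO₁ y x z hy hx hz hmax' hcen' g₀ c' hc'
        A₀ hA₀m hvA₀ β₀ α₀ β₁ α₁ e₀ e₁ b₀' a₀' b₀₂ b₀₁ a₀₂ a₀₁ b₁' a₁' b₁₂ b₁₁ a₁₂ a₁₁ hb₀' ha₀' hb₀₂ hb₀₁ ha₀₂ ha₀₁ hb₁' ha₁' hb₁₂ hb₁₁ ha₁₂ ha₁₁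
        (by rw [hβ₀eq]; ring) (by rw [hα₀eq]; ring) (by rw [hβ₁eq]; ring) (by rw [hα₁eq]; ring) hvb₀' huni₁'.symm hdet' (a 0) (a 1) (ha 0) (ha 1) hG''

end Summit.ResolutionOfSingularities.ResolutionOfSingularities.Theorems.RadicialJung.CleanModels.Ccurve

end
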